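import Summits.Ventures.GridStability.Models.DroopQVGainAffine
import Summits.Ventures.GridStability.Models.WSCC9DroopQVGainRayCert
import Summits.Ventures.GridStability.Models.DroopQVPortHamiltonianSpectrum

/-!
# GridStability/Models/WSCC9DroopQVGainRay — a certificate on an UNBOUNDED parameter ray: for EVERY uniform P–f droop gain `k_P ≥ 1/2` the linearisation of the lossless construction «DROOPQV-WSCC9» at its (gain-independent) rest point is the rotation mode or has `Re z < −1`

Cell `gridfusion` (LADDER-GRIDFUSION, APEX LINE rung G3.b; seat gridfusion-model-8 (g4); default-work item (B) after lead g8 RULING 9ax (1), offered as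
«G3.b-ss-DROOPQV-WSCC9-GAIN-RAY-RATE»). Instance of `Models/DroopQVGainAffine.lean` (p558197) on #51's LOSSLESS object `WSCC9.droopQV` (p519344) with the data
file `Models/WSCC9DroopQVGainRayCert.lean`.
STATEMENT (`droopQV_gain_eig_re_lt`): for every real `k_P ≥ 1/2`, every complex eigenpair `(z, v)` of the `9 × 9` Jacobian `jacMatrix (θ*, V*)` of
`droopQVk k_P := droopQV.toMicrogrid.withKP (fun _ => k_P)` (the lossless construction with all three P–f droop gains `k_P`; rest point unchanged,
`droopQV_gain_field_eq_zero`) is the rotation mode (`z = 0`, `v ∈ ℂ·r`) or has `Re z < −1`; the rotation zero is algebraically simple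
(`droopQV_gain_no_jordan_chain_at_zero`). No upper limit on the gain: in the equivalent swing model (`DroopMicrogrid.toClassicalSwing`) this is EVERY
virtual inertia `τ_P/k_P ≤ 1` with damping `1/k_P ≤ 2`, down to zero inertia. (At `k_P = 243/100` this is the #51 object; ★ #68′ gives `Re μ < 0 ∨ rotation`
for ALL gains of the lossless family without a rate — here the RATE `1 = 1/(2τ_P)` is certified on the whole ray.)
CERTIFICATE (solver-free in the kernel): `J(k) = J′(0) + k·J₁` affine (`DroopMicrogrid.jacMatrix_withKP_add`); AFFINE Lyapunov family `S(k) = S₀ + k·S₁`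
with `S₀[ω, ω] = c₀·1` and `S₁`'s angle rows `= −c₀·J₁[ω, ·]` (data file §2), whence `S₁J₁ = 0` (so `H(k) = H(0) + k·H₁`, `lyapCert_affine`) AND the
frequency rows of `H₁` vanish; the two slopes `S₁`, `H₁` are positive SEMIdefinite: kernel `span(e_ω₁, e_ω₂, e_ω₃, r)` exactly (data file
`ray9_slopes_kernel`) and `S₁ + Λ ≻ 0`, `H₁ + Λ ≻ 0` for the orthogonal lift `Λ = r rᵀ + Σ e_ωi e_ωiᵀ` (Gram certificates), peeled by
`posSemidef_of_orth_lifts` (§0, four applications of the lifting lemma `posSemidef_of_posSemidef_add_rankOne`, p522771); with `S(1/2) ≻ 0`, `H(1/2) ≻ 0`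
(Gram certificates) the ray lemma `posDef_affine_of_posSemidef_slope` gives `S(k) ≻ 0`, `H(k) ≻ 0` for EVERY `k ≥ 1/2`, and
`eig_re_lt_neg_of_deflate_withKP` (deflation `ζ = zetaL`, `γ = −3`) concludes. WHY A RAY IS POSSIBLE HERE AND NOT FOR THE LOSSY TWIN
(`Models/WSCC9DroopQVLossyGainBox.lean`, a bounded box): `H₁ ⪰ 0` forces `H₁`'s frequency rows to vanish, i.e. `S₁[θ, ·] = −W·J₁[ω, ·]` with
`W = S₀[ω, ω]`, `W·Pθ` symmetric and `1ᵀW·PV = 0`; with `G = 0` one has `Σ_i P_i ≡ 0`, hence `1ᵀ·PV = 0` and `W = c₀·1` works — with conductances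
`1ᵀ·PV = ∂(losses)/∂V ≠ 0` and no admissible `W` exists generically.
DATA: packet `HOME/models/gen-model-8/g4/GAINRAY-WSCC9-cert.json` (sha16 2d5f5204fee825c4). Informative floats (ours, VALIDATED only): non-rotation abscissa of `J(k_P)`
for `k_P ∈ {1/2, …, 10⁴}` ∈ `[-1.0271, -1.0125]` (tends to `≈ −1.027` as `k_P → ∞`: the swing-like modes keep real part `≈ −1/(2τ_P)` while their
frequency grows like `√k_P`); structured LMI margin `t* ≈ 7.1e-03`.
THREE COLUMNS. CERTIFIED (kernel): matrix statements about the MODEL `droopQVk k_P`, every real `k_P ≥ 1/2`. MODELLED: MV-6N (KunduEtAl2019 (4a)–(4c) with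
Q–V dynamics) — SYNTHETIC/CONSTRUCTION as #51 (h12 `B` of record, `G := 0` lossless, no loads; `k_Q = 1/5`, `τ_P = τ_Q = 1/2` AS PRINTED
[cite: KunduEtAl2019, §V]; `k_P` the PARAMETER; set-points DEFINED from `(θ*, V*)`). VALIDATED: the float LMI solve behind `S₀, S₁`, float spectra.
A statement about the linearisation at ONE rest point for a RAY of gains — never a region of attraction, never the printed WSCC system; no sentence of this
file says a grid, a microgrid or a converter is stable.
-/

noncomputable section

open Real Matrix Finset
open scoped ComplexOrder
open Literature.Computation.Certificates

namespace Summit.Ventures.GridStability.Models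

/-! ## §0 Peeling orthogonal rank-one lifts off a semidefinite certificate -/

section Lift

variable {ι : Type*} [Fintype ι]

/-- `(a bᵀ) v = (bᵀv)·a`. [folklore] -/
theorem vecMulVec_mulVec_eq_smul (a b v : ι → ℝ) : Matrix.vecMulVec a b *ᵥ v = (b ⬝ᵥ v) • a := by
  funext i
  simp only [Matrix.mulVec, dotProduct, Matrix.vecMulVec_apply, Pi.smul_apply, smul_eq_mul, Finset.sum_mul]
  exact Finset.sum_congr rfl fun j _ => by ring

/-- **Peeling lemma.** `X` real symmetric killing pairwise-orthogonal vectors `u₁, …, u_m`; if `X + Σ uᵢuᵢᵀ ⪰ 0` then `X ⪰ 0` (the lifting lemma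
`posSemidef_of_posSemidef_add_rankOne`, p522771, applied `m` times). [folklore] -/
theorem posSemidef_of_orth_lifts :
    ∀ (us : List (ι → ℝ)) (X : Matrix ι ι ℝ), Xᵀ = X → (∀ u ∈ us, X *ᵥ u = 0) → us.Pairwise (fun a b => a ⬝ᵥ b = 0) →
      (X + (us.map fun u => Matrix.vecMulVec u u).sum).PosSemidef → X.PosSemidef := by
  intro us
  induction us with
  | nil => intro X _ _ _ h; simpa using h
  | cons u rest ih =>
      intro X hX hker horth h
      rw [List.pairwise_cons] at horth
      have hX' : (X + Matrix.vecMulVec u u)ᵀ = X + Matrix.vecMulVec u u := by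
        rw [Matrix.transpose_add, Matrix.transpose_vecMulVec, hX]
      have hker' : ∀ w ∈ rest, (X + Matrix.vecMulVec u u) *ᵥ w = 0 := fun w hw => by
        rw [Matrix.add_mulVec, hker w (List.mem_cons_of_mem u hw), vecMulVec_mulVec_eq_smul, horth.1 w hw, zero_smul, add_zero]
      have h' : (X + Matrix.vecMulVec u u + (rest.map fun u => Matrix.vecMulVec u u).sum).PosSemidef := by
        simpa [List.map_cons, List.sum_cons, add_assoc] using h
      have hpsd := ih (X + Matrix.vecMulVec u u) hX' hker' horth.2 h'
      exact posSemidef_of_posSemidef_add_rankOne hX (hker u (List.mem_cons_self)) (c := 1) (by simpa using hpsd)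

/-- Cast plumbing: `(X.map ℚ→ℝ)·(u cast) = (X·u) cast`. [folklore] -/
theorem map_ratCast_mulVec {N : ℕ} (X : Matrix (Fin N) (Fin N) ℚ) (u : Fin N → ℚ) :
    X.map ((↑) : ℚ → ℝ) *ᵥ (fun i => (u i : ℝ)) = fun i => ((X *ᵥ u) i : ℝ) := by
  funext i
  simp only [Matrix.mulVec, dotProduct, Matrix.map_apply]
  push_cast
  rfl

/-- Cast plumbing: dot products. [folklore] -/
theorem ratCast_dotProduct {N : ℕ} (a b : Fin N → ℚ) :
    (fun i => (a i : ℝ)) ⬝ᵥ (fun i => (b i : ℝ)) = ((a ⬝ᵥ b : ℚ) : ℝ) := by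
  simp only [dotProduct]
  push_cast
  rfl

end Lift

namespace WSCC9

/-! ## §1 The one-parameter family (lossless) and its gain-independent rest point -/

/-- **The lossless construction with uniform P–f droop gain `k_P`** (everything else as `droopQV`). MODELLED: SYNTHETIC/CONSTRUCTION, lossless,
`k_P` a parameter. [folklore] -/
def droopQVk (k : ℝ) : DroopMicrogrid 3 := droopQV.toMicrogrid.withKP (fun _ => k)

/-- The printed gains of the base instance: `k_P = 243/100` on every unit. [cite: KunduEtAl2019, §V] -/
theorem droopQV_kP (i : Fin 3) : droopQV.toMicrogrid.kP i = (243 : ℝ) / 100 := by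
  have h : droopQV.kP i = 243 / 100 := rfl
  rw [DroopQVData.toMicrogrid_kP, h]; push_cast; ring

/-- Moving the uniform gain: `withKP (k_P + (k − 243/100)·1) = droopQVk k`. [folklore] -/
theorem droopQVk_eq (k : ℝ) : droopQV.toMicrogrid.withKP (fun i => droopQV.toMicrogrid.kP i + (k - 243 / 100) * (1 : ℝ)) = droopQVk k := by
  unfold droopQVk
  congr 1
  funext i
  rw [droopQV_kP]; ring

/-- **The rest point does not move with the gain.** [folklore] -/
theorem droopQV_gain_field_eq_zero (k : ℝ) : (droopQVk k).field (droopQV.angleOf, 0, droopQV.Vstar) = 0 :=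
  droopQV.toMicrogrid.withKP_field_eq_zero (fun _ => k) droopQV.isSteadyState

/-- The Jacobian named below IS the derivative of the field of `droopQVk k` (generic kernel fact, every state). [folklore] -/
theorem droopQV_gain_hasFDerivAt_field (k : ℝ) (x : DroopMicrogrid.State 3) :
    HasFDerivAt (droopQVk k).field ((droopQVk k).jacCLM x) x :=
  (droopQVk k).hasFDerivAt_field x

/-! ## §2 Bridges: the deflated Jacobian of `droopQVk k` is `J′(0) + k·J₁`, reindexed -/

/-- The deflated Jacobian of the base instance IS `ray9JstarQ`, reindexed. [folklore] -/
theorem droopQV_jacDefl_eq : droopQV.toMicrogrid.jacDefl droopQV.angleOf droopQV.Vstar zetaL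
    = (ray9JstarQ.map ((↑) : ℚ → ℝ)).submatrix e9 e9 := by
  rw [DroopMicrogrid.jacDefl, droopQV.jacMatrix_eq droopQV_circle]
  ext a b
  have h := ray9JstarQ_spec a b
  simp only [Matrix.add_apply, Matrix.vecMulVec_apply] at h
  simp only [Matrix.add_apply, Matrix.vecMulVec_apply, Matrix.map_apply, Matrix.submatrix_apply, ← h]
  push_cast
  congr 1
  rcases a with i | i | i <;> rcases b with j | j | j <;> simp [DroopMicrogrid.rot, rotLQ, zetaL, zetaLQ]

/-- The slope of the base instance IS `ray9J1Q`, reindexed. [folklore] -/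
theorem droopQV_jacSlope_eq : droopQV.toMicrogrid.jacSlope (fun _ => (1 : ℝ)) droopQV.angleOf droopQV.Vstar
    = (ray9J1Q.map ((↑) : ℚ → ℝ)).submatrix e9 e9 := by
  rw [droopQV.jacSlope_eq droopQV_circle]
  ext a b
  have h := ray9J1Q_spec a b
  simp only [DroopQVData.jacSlopeQ, Matrix.map_apply, Matrix.submatrix_apply, ← h]

/-- The real affine pencil of deflated Jacobians `J′(k) = J′(0) + k·J₁` (flattened). [folklore] -/
def ray9J9 (k : ℝ) : Matrix (Fin 9) (Fin 9) ℝ := ray9J0Q.map ((↑) : ℚ → ℝ) + k • ray9J1Q.map ((↑) : ℚ → ℝ)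

/-- **The deflated Jacobian of `droopQVk k` at `(θ*, V*)` IS `J′(k)`, reindexed.** [folklore] -/
theorem droopQVk_jacDefl_eq (k : ℝ) : (droopQVk k).jacDefl droopQV.angleOf droopQV.Vstar zetaL = (ray9J9 k).submatrix e9 e9 := by
  rw [← droopQVk_eq, DroopMicrogrid.jacDefl_withKP_add, droopQV_jacDefl_eq, droopQV_jacSlope_eq, ray9J9, ray9J0Q, map_ratCast_add_smul]
  ext a b
  simp only [Matrix.add_apply, Matrix.smul_apply, Matrix.submatrix_apply, smul_eq_mul]
  push_cast
  ring

/-! ## §3 The affine Lyapunov family over `ℝ`; both slopes are positive semidefinite -/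

/-- `S(k) = S₀ + k·S₁` over `ℝ` (flattened). [folklore] -/
def ray9S9 (k : ℝ) : Matrix (Fin 9) (Fin 9) ℝ := ray9S0Q.map ((↑) : ℚ → ℝ) + k • ray9S1Q.map ((↑) : ℚ → ℝ)

/-- `H(k) = S(k)(−J′(k)) + (S(k)(−J′(k)))ᵀ − 2·S(k)` over `ℝ` (rate `r₀ = 1`). [folklore] -/
def ray9H9 (k : ℝ) : Matrix (Fin 9) (Fin 9) ℝ := ray9S9 k * (-ray9J9 k) + (ray9S9 k * (-ray9J9 k))ᵀ - (2 * (1 : ℝ)) • ray9S9 k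

/-- Cast plumbing for the slope `H₁`. [folklore] -/
theorem ray9H1Q_map : ray9H1Q.map ((↑) : ℚ → ℝ)
    = -(ray9S0Q.map ((↑) : ℚ → ℝ) * ray9J1Q.map ((↑) : ℚ → ℝ) + ray9S1Q.map ((↑) : ℚ → ℝ) * ray9J0Q.map ((↑) : ℚ → ℝ))
      - (ray9S0Q.map ((↑) : ℚ → ℝ) * ray9J1Q.map ((↑) : ℚ → ℝ) + ray9S1Q.map ((↑) : ℚ → ℝ) * ray9J0Q.map ((↑) : ℚ → ℝ))ᵀ
      - (2 * (1 : ℝ)) • ray9S1Q.map ((↑) : ℚ → ℝ) := by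
  ext i j
  simp only [ray9H1Q, Matrix.map_apply, Matrix.sub_apply, Matrix.neg_apply, Matrix.add_apply, Matrix.mul_apply, Matrix.transpose_apply,
    Matrix.smul_apply, smul_eq_mul]
  push_cast
  rfl

/-- **`H(k)` is AFFINE**: `H(k) = H(0) + k·H₁`. [folklore] -/
theorem ray9H9_affine (k : ℝ) : ray9H9 k = ray9H9 0 + k • ray9H1Q.map ((↑) : ℚ → ℝ) := by
  have h0 : ray9S1Q.map ((↑) : ℚ → ℝ) * ray9J1Q.map ((↑) : ℚ → ℝ) = 0 := by
    rw [← map_ratCast_mul, ray9S1Q_mul_J1Q]; simp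
  have h := lyapCert_affine (ray9S0Q.map ((↑) : ℚ → ℝ)) (ray9S1Q.map ((↑) : ℚ → ℝ)) (ray9J0Q.map ((↑) : ℚ → ℝ)) (ray9J1Q.map ((↑) : ℚ → ℝ))
    (2 * (1 : ℝ)) k h0
  have h' := lyapCert_affine (ray9S0Q.map ((↑) : ℚ → ℝ)) (ray9S1Q.map ((↑) : ℚ → ℝ)) (ray9J0Q.map ((↑) : ℚ → ℝ)) (ray9J1Q.map ((↑) : ℚ → ℝ))
    (2 * (1 : ℝ)) 0 h0
  rw [ray9H9, ray9S9, ray9J9, h, ray9H9, ray9S9, ray9J9, h', zero_smul, add_zero, ray9H1Q_map]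

/-- The lift over `ℝ` is the list-sum of the four rank-one matrices. [folklore] -/
theorem ray9LiftQ_map : ray9LiftQ.map ((↑) : ℚ → ℝ)
    = ([fun i => (ray9e5 i : ℝ), fun i => (ray9e4 i : ℝ), fun i => (ray9e3 i : ℝ), fun i => (ray9r i : ℝ)].map
        fun u => Matrix.vecMulVec u u).sum := by
  ext i j
  simp [ray9LiftQ, Matrix.vecMulVec_apply, Matrix.add_apply]
  ring

/-- **The slope `S₁` is positive semidefinite** (lifted Gram certificate + kernel facts, peeled). CERTIFIED. [folklore] -/
theorem ray9S1_posSemidef : (ray9S1Q.map ((↑) : ℚ → ℝ)).PosSemidef := by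
  obtain ⟨k1, k2, k3, k4, -, -, -, -, hs, -⟩ := ray9_slopes_kernel
  obtain ⟨o1, o2, o3, o4, o5, o6⟩ := ray9_lift_orth
  refine posSemidef_of_orth_lifts
    [fun i => (ray9e5 i : ℝ), fun i => (ray9e4 i : ℝ), fun i => (ray9e3 i : ℝ), fun i => (ray9r i : ℝ)] _ ?_ ?_ ?_ ?_
  · rw [← Matrix.transpose_map, hs]
  · intro u hu
    simp only [List.mem_cons, List.not_mem_nil, or_false] at hu
    rcases hu with rfl | rfl | rfl | rfl <;> simp [map_ratCast_mulVec, k1, k2, k3, k4] <;> rfl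
  · refine List.pairwise_cons.2 ⟨?_, List.pairwise_cons.2 ⟨?_, List.pairwise_cons.2 ⟨?_, List.pairwise_singleton _ _⟩⟩⟩
    · intro b hb
      simp only [List.mem_cons, List.not_mem_nil, or_false] at hb
      rcases hb with rfl | rfl | rfl
      · rw [ratCast_dotProduct, o1, Rat.cast_zero]
      · rw [ratCast_dotProduct, o2, Rat.cast_zero]
      · rw [ratCast_dotProduct, o3, Rat.cast_zero]
    · intro b hb
      simp only [List.mem_cons, List.not_mem_nil, or_false] at hb
      rcases hb with rfl | rfl
      · rw [ratCast_dotProduct, o4, Rat.cast_zero]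
      · rw [ratCast_dotProduct, o5, Rat.cast_zero]
    · intro b hb
      rw [List.mem_singleton] at hb
      subst hb
      rw [ratCast_dotProduct, o6, Rat.cast_zero]
  · rw [← ray9LiftQ_map, ← Matrix.map_add _ (fun a b => Rat.cast_add a b)]
    exact rayS1L_posDef.posSemidef

/-- **The slope `H₁` is positive semidefinite** (same mechanism). CERTIFIED. [folklore] -/
theorem ray9H1_posSemidef : (ray9H1Q.map ((↑) : ℚ → ℝ)).PosSemidef := by
  obtain ⟨-, -, -, -, k1, k2, k3, k4, -, hh⟩ := ray9_slopes_kernel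
  obtain ⟨o1, o2, o3, o4, o5, o6⟩ := ray9_lift_orth
  refine posSemidef_of_orth_lifts
    [fun i => (ray9e5 i : ℝ), fun i => (ray9e4 i : ℝ), fun i => (ray9e3 i : ℝ), fun i => (ray9r i : ℝ)] _ ?_ ?_ ?_ ?_
  · rw [← Matrix.transpose_map, hh]
  · intro u hu
    simp only [List.mem_cons, List.not_mem_nil, or_false] at hu
    rcases hu with rfl | rfl | rfl | rfl <;> simp [map_ratCast_mulVec, k1, k2, k3, k4] <;> rfl
  · refine List.pairwise_cons.2 ⟨?_, List.pairwise_cons.2 ⟨?_, List.pairwise_cons.2 ⟨?_, List.pairwise_singleton _ _⟩⟩⟩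
    · intro b hb
      simp only [List.mem_cons, List.not_mem_nil, or_false] at hb
      rcases hb with rfl | rfl | rfl
      · rw [ratCast_dotProduct, o1, Rat.cast_zero]
      · rw [ratCast_dotProduct, o2, Rat.cast_zero]
      · rw [ratCast_dotProduct, o3, Rat.cast_zero]
    · intro b hb
      simp only [List.mem_cons, List.not_mem_nil, or_false] at hb
      rcases hb with rfl | rfl
      · rw [ratCast_dotProduct, o4, Rat.cast_zero]
      · rw [ratCast_dotProduct, o5, Rat.cast_zero]
    · intro b hb
      rw [List.mem_singleton] at hb
      subst hb
      rw [ratCast_dotProduct, o6, Rat.cast_zero]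
  · rw [← ray9LiftQ_map, ← Matrix.map_add _ (fun a b => Rat.cast_add a b)]
    exact rayH1L_posDef.posSemidef

/-! ## §4 The certificates on the whole ray `k ≥ 1/2` -/

/-- `S(k) ≻ 0` for every `k ≥ 1/2`. CERTIFIED. [folklore] -/
theorem ray9S9_posDef {k : ℝ} (hk : (1 : ℝ) / 2 ≤ k) : (ray9S9 k).PosDef := by
  have ha : (ray9S0Q.map ((↑) : ℚ → ℝ) + ((((1 : ℚ) / 2 : ℚ)) : ℝ) • ray9S1Q.map ((↑) : ℚ → ℝ)).PosDef := by
    rw [← map_ratCast_add_smul]; exact raySA_posDef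
  exact posDef_affine_of_posSemidef_slope ha ray9S1_posSemidef (by push_cast; linarith)

/-- `H` at `k = 1/2`, read through the real pencil. [folklore] -/
theorem ray9H9_half : ray9H9 ((((1 : ℚ) / 2 : ℚ)) : ℝ) = ray9HAQ.map ((↑) : ℚ → ℝ) := by
  rw [ray9HAQ, ray9SAQ, ray9JAQ, map_ratCast_lyapCert, map_ratCast_add_smul, map_ratCast_add_smul, ray9H9, ray9S9, ray9J9]
  push_cast
  rfl

/-- `H(k) ≻ 0` for every `k ≥ 1/2`. CERTIFIED. [folklore] -/
theorem ray9H9_posDef {k : ℝ} (hk : (1 : ℝ) / 2 ≤ k) : (ray9H9 k).PosDef := by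
  have ha : (ray9H9 ((((1 : ℚ) / 2 : ℚ)) : ℝ)).PosDef := by rw [ray9H9_half]; exact rayHA_posDef
  rw [ray9H9_affine] at ha ⊢
  exact posDef_affine_of_posSemidef_slope ha ray9H1_posSemidef (by push_cast; linarith)

/-! ## §5 The statement on the ray -/

/-- **RATE CERTIFICATE ON AN UNBOUNDED GAIN RAY (lossless construction).** For EVERY uniform P–f droop gain `k_P ≥ 1/2`, every complex eigenpair
`(z, v)` of the `9 × 9` Jacobian `jacMatrix (θ*, V*)` of `droopQVk k_P` (= «DROOPQV-WSCC9» with all three P–f gains `k_P`) is the rotation mode (`z = 0`,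
`v ∈ ℂ·r`) or has `Re z < −1`. CERTIFIED (one affine Lyapunov family with positive semidefinite slopes, four integer Gram certificates, deflation
`γ = −3`); MODELLED: MV-6N SYNTHETIC/CONSTRUCTION, lossless, `k_P` the parameter; VALIDATED: float abscissa `∈ [-1.0271, -1.0125]` for
`k_P ∈ [1/2, 10⁴]`. A statement about the linearisation at ONE rest point for a RAY of gains — not a region of attraction; no stability sentence. [folklore] -/
theorem droopQV_gain_eig_re_lt {k : ℝ} (hk : (1 : ℝ) / 2 ≤ k)
    {z : ℂ} {v : Fin 3 ⊕ (Fin 3 ⊕ Fin 3) → ℂ} (hv : v ≠ 0)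
    (hJ : ((droopQVk k).jacMatrix droopQV.angleOf droopQV.Vstar).map ((↑) : ℝ → ℂ) *ᵥ v = z • v) :
    (z = 0 ∧ ∃ a : ℂ, v = fun i => a * (DroopMicrogrid.rot i : ℂ)) ∨ z.re < -1 := by
  have hS : ((ray9S9 k).submatrix e9 e9).PosDef := (ray9S9_posDef hk).submatrix e9.injective
  have hH : ((ray9S9 k).submatrix e9 e9 * (-(droopQVk k).jacDefl droopQV.angleOf droopQV.Vstar zetaL)
      + ((ray9S9 k).submatrix e9 e9 * (-(droopQVk k).jacDefl droopQV.angleOf droopQV.Vstar zetaL))ᵀ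
      - (2 * (1 : ℝ)) • (ray9S9 k).submatrix e9 e9).PosDef := by
    rw [droopQVk_jacDefl_eq, lyapCert_submatrix]
    exact (ray9H9_posDef hk).submatrix e9.injective
  exact droopQV.toMicrogrid.eig_re_lt_neg_of_deflate_withKP (fun _ => k) droopQV.angleOf droopQV.Vstar zetaL one_pos
    (by simpa using zetaL_gamma.trans (by norm_num : -((1041 : ℝ) / 1000) < -1)) hS hH hv hJ

/-- **SIMPLE rotation zero on the whole ray**: for every `k_P ≥ 1/2` no complex `w` solves `jacMatrix (θ*, V*) w = r` for `droopQVk k_P`.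
CERTIFIED (same certificate family); MODELLED as above. No stability sentence. [folklore] -/
theorem droopQV_gain_no_jordan_chain_at_zero {k : ℝ} (hk : (1 : ℝ) / 2 ≤ k) {w : Fin 3 ⊕ (Fin 3 ⊕ Fin 3) → ℂ}
    (hw : ((droopQVk k).jacMatrix droopQV.angleOf droopQV.Vstar).map ((↑) : ℝ → ℂ) *ᵥ w
      = fun i => ((DroopMicrogrid.rot i : ℝ) : ℂ)) : False := by
  have hS : ((ray9S9 k).submatrix e9 e9).PosDef := (ray9S9_posDef hk).submatrix e9.injective
  have hH : ((ray9S9 k).submatrix e9 e9 * (-(droopQVk k).jacDefl droopQV.angleOf droopQV.Vstar zetaL)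
      + ((ray9S9 k).submatrix e9 e9 * (-(droopQVk k).jacDefl droopQV.angleOf droopQV.Vstar zetaL))ᵀ
      - (2 * (1 : ℝ)) • (ray9S9 k).submatrix e9 e9).PosDef := by
    rw [droopQVk_jacDefl_eq, lyapCert_submatrix]
    exact (ray9H9_posDef hk).submatrix e9.injective
  exact droopQV.toMicrogrid.no_jordan_chain_at_zero_of_deflate_withKP (fun _ => k) droopQV.angleOf droopQV.Vstar zetaL one_pos
    (by simpa using zetaL_gamma.trans (by norm_num : -((1041 : ℝ) / 1000) < -1)) hS hH hw

end WSCC9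

end Summit.Ventures.GridStability.Models

end
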